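import Summits.QuantumFields.YangMills.Theorems.BalabanUVNodesN07Prop4LetterHOfThm312
import HarnessLib

/-!
# THE ONE-BLOCK KERNEL LETTER (KL-H) OF THE RECORD's `H₁(U₀)` FROM [B9] THEOREM 3.12 BY NAME — the SAME displayed antecedent as (ℓa-H)

Cell `pub-ymgap` (HUMAN RULING D-0062, Track A), node N07 [B11] ∕ the K0ᴬ port wall; seat `pub-ymgap-dag-n06-l` (g42; N06 bundle F7 = [B9] Thms 3.12∕3.13, lineage author of
`Lit/B9Thm312Whole*`), on dag-lead WORDS 795 («dag-n06-l g42 -b := KL-H (S) pen … sequenced AFTER dag-n07-e g39 INTENT-1») and ★★★ director-ym №583 (2) («KL-H … LOCATED, UNOWNED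
(R1)-row»).  `--kind proof --supports stmt-QuantumFields-27238 --as helper`; count-neutral.  [B9] = [Balaban1985BackgroundPropagators]; [B11] = [Balaban1985Variational]; [4] =
[Balaban1984PropagatorsII].

THE PRINT.  [B9] p. 422: «The above inequality [(3.132)] together with Theorem 3.3 for G … give |H_{μν}(x, y′)|, |∇H_{μν}(x, y′)| … ≦ O(1)[1, (Lʲη)⁻¹, …](L^{j′}η)^{−d}
e^{−½δ₁d(y,y′)}, for x ∈ Δ(y) … (3.133)»; p. 423: «From (3.129) and (3.132) with G₁ instead of G we get the inequalities (3.133) for H₁»; [B11] p. 291 (88): «Applying the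
inequalities (3.132) from [5] …»; [4] Lemma 2.1 (2.61) p. 234.

WHAT (KL-H) IS, LOCATED (★ PT-B g8 ✓`…Prop4ColumnsAtRecord` §2, the binders `hk0 hHk hΘH hH1 hΘHw hHw`): a majorant `hk(b′, y)` of the FINE-bond values of the columns of the
record's `H₁(U₀) = H1OfRecordAtBgFlat …`, `‖flat115 (H₁(U₀)(δ_y Z)) b′‖ ≤ hk(b′, y)‖Z‖`, with plain fine-column sums `Σ_{b′} hk(b′, y) ≤ Θ_H` and (3)∕(3)-weighted ones `≤ Θ_H^w`.
dag-n07-e g39 ✓`…N07Prop4LetterHOfThm312` (p826224) READS the same `H₁(U₀)` by its columns `h1Col0 y′ x` and block sup-entries `h1Entry0 y y′` and DISPLAYS [B9] Theorem 3.12 at the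
record instance `(geoRecN00, bgRecN00, h1KernelRecN00)` as the antecedent of (ℓa-H).  THIS FILE supplies (KL-H) from THE SAME displayed antecedent, so that (ℓa-H) and (KL-H) are
ONE displayed row (Theorem 3.12 at the record), not two:
* §1 `card_fiber_blkOfBond_le` — an observation block `Δ(y)` carries at most `(L^d)^k` fine bonds of the given direction (lit ✓`B5Eq118OneStroke.card_iterBlock`, standing range
  `k ≤ m + K`); `sum_over_blocks_le` — a fine-bond sum of a block function is at most `(L^d)^k ×` the block sum.
* §2 (one member) `flat115_H1_single` (the (KL-H) reading IS n07-e's column: `flat115 (H₁(δ_y Z)) b′ = h1Col0 y b′ Z`, `rfl`-level); `levWeight_bondLevLit_eq_one_pow` (node-00: every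
  (115) weight is `1`); ★★ `klH_of_h1EntryBounds` — from (3.133)-shaped bounds `h1Entry0 y y′ ≤ B₀e^{−ρ·d(y,y′)}` on the record's zeroth sup-entry: the four (KL-H) facts with
  `hk(b′, y) := ‖h1Col0 y b′‖_op`, `Θ_H = Θ_H^w := (L^d)^k · B₀ · d(2(1+1∕ρ))^d` ((2.61) row sum, n07-e's ✓`rowSum_PBond_le`).
* §3 (family) ★★★ `klH_of_thm312Printed` — from `B9.Thm312Printed 4 c35 (geoRecN00 F) (bgRecN00 F N R35 R36) GD G₁ H (h1KernelRecN00 F N a R35 R36) …` (n07-e's displayed antecedent,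
  VERBATIM) ⟹ `∃ M₄ a₀ B₀ δ₀ > 0` such that at every member `i` (`M₄ ≤ Mc`, `k ≤ m + K`), every `0 < α₀` (`Mc·α₀ ≤ a₀`), every `U₀` in the displayed classes `R35 ∕ R36` and every
  pair of def-Y's displayed proofs `hpos hQ`, the (KL-H) package holds with `hk := ‖h1Col0 …‖`, `Θ_H = Θ_H^w := (L^d)^k · B₀ · d(2(1+2∕δ₀))^d` — PT-B G1's six (KL-H) binders by name.
HONEST SIZE OF THE CONSTANT: `Θ_H ~ (L^d)^k` (the number of fine bonds per unit block — the columns are read on the FINE lattice at counting measure); PT-B's located sizing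
(PORT-PLAN-v6 (S-ℓd)) expects exactly this, compensated by `G ~ L^{−kd}` in the window `(ε_C + a_C)·Θ_H·G ≤ ½`.

HONEST FRAMING.  Kernel bookkeeping over landed modules; NO estimate of [B9] is proved: Theorem 3.12 at the record (N06's row, a second instance of it — see this seat's located note
I.12896), the readings `R35 ∕ R36` and def-Y's `hpos ∕ hQ` stay DISPLAYED; (KL-N), (KL-C), (ℓd)'s window untouched; K0ᴬ ⟨stmt-QuantumFields-27238⟩ NOT closed; K0ᴬ∕K1ᴬ∕K3ᴬ 0∕3;
NODE O 0∕1; COUNT 8∕28 · K 1∕4 UNMOVED; finite `𝕋⁴_{L^K}` at fixed ε — NOT continuum ∕ ℝ⁴ ∕ OS; **the Yang–Mills mass gap (Clay) is NOT proved by any of this.**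
No `sorry`, `instance`, `notation`, `set_option`; standard axioms.
-/

noncomputable section

open scoped Matrix Matrix.Norms.L2Operator InnerProductSpace ComplexConjugate BigOperators

namespace Summit.QuantumFields.YangMills.BalabanUVNodes.N07KLHOfThm312

open Literature.MathematicalPhysics.QuantumFieldTheory.Balaban1983to89
open Literature.MathematicalPhysics.QuantumFieldTheory.Balaban1983to89.Node00
open T4Continuum (T4Family)
open B9SectCLatticeCarrier (Bond)
open B11Eq115Space (NegSup NegSize Space115 JetSup levWeight levWeight_apply)
open B11Eq111FrakG (nabla115)
open B11Eq90V0primeCurrent (flat115 flat115_apply)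
open B11KernelDictionary (fsup le_fsup fsup_nonneg)
open B5Eq118OneStroke (iterBlockOf iterBlock mem_iterBlock card_iterBlock)
open Summit.QuantumFields.YangMills.Theorems.C44IterMh (L_pow_mul_eta_real levWeight_bondLevLit_eq_one)
open Summit.QuantumFields.YangMills.BalabanUVNodes.N07Prop4LetterHOfThm312

/-! ## §1  Counting the fine bonds of an observation block -/

section Count

variable (F : T4Family) (K k : ℕ)

/-- **AT MOST `(L^d)^k` FINE BONDS PER OBSERVATION BLOCK**: the fine bonds `b′` with `Δ⁻¹(b′) = y` (same `k`-fold block point of the base, same direction) inject by their base into the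
block of order `k` over `y`'s source, which has `(L^d)^k` sites (standing range `k ≤ m + K`). [cite: Balaban1984PropagatorsI, (1.18) p.20; Balaban1985BackgroundPropagators, (3.41) p.397] -/
theorem card_fiber_blkOfBond_le (hk : k ≤ (F.P K).m + (F.P K).K) (y : PBond (F.P K) k) :
    (Finset.univ.filter (fun b' : Bond (F.P K).d (fun _ => (F.P K).sitesPerDir 0) => blkOfBond F K k b' = y)).card ≤
      ((F.P K).L ^ (F.P K).d) ^ k := by
  classical
  rw [← card_iterBlock k hk y.src]
  refine Finset.card_le_card_of_injOn (fun b' => ((bondToLit (F.P K) 0).symm b').src) (fun b' hb' => ?_) (fun b₁ h₁ b₂ h₂ heq => ?_)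
  · simp only [Finset.coe_filter, Finset.mem_univ, true_and, Set.mem_setOf_eq] at hb'
    simp only [Finset.mem_coe, mem_iterBlock]
    have h := congrArg PBond.src hb'
    exact h
  · simp only [Finset.coe_filter, Finset.mem_univ, true_and, Set.mem_setOf_eq] at h₁ h₂
    have hd₁ := congrArg PBond.dir h₁
    have hd₂ := congrArg PBond.dir h₂
    simp only [blkOfBond] at hd₁ hd₂
    apply (bondToLit (F.P K) 0).symm.injective
    rcases hb₁ : (bondToLit (F.P K) 0).symm b₁ with ⟨s₁, μ₁⟩
    rcases hb₂ : (bondToLit (F.P K) 0).symm b₂ with ⟨s₂, μ₂⟩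
    simp only [hb₁, hb₂] at heq hd₁ hd₂
    simp only [heq, hd₁, hd₂]

/-- **A FINE-BOND SUM OF A BLOCK FUNCTION** is at most `(L^d)^k` times the block sum (non-negative summand). [cite: Balaban1984PropagatorsII, (2.52) p.232 («A summation preserves it also»)] -/
theorem sum_over_blocks_le (hk : k ≤ (F.P K).m + (F.P K).K) (f : PBond (F.P K) k → ℝ) (hf : ∀ y, 0 ≤ f y) :
    ∑ b' : Bond (F.P K).d (fun _ => (F.P K).sitesPerDir 0), f (blkOfBond F K k b') ≤
      (((F.P K).L ^ (F.P K).d) ^ k : ℕ) * ∑ y : PBond (F.P K) k, f y := by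
  classical
  rw [← Finset.sum_fiberwise_of_maps_to (s := Finset.univ) (t := Finset.univ) (g := fun b' => blkOfBond F K k b') (fun _ _ => Finset.mem_univ _)
    (fun b' => f (blkOfBond F K k b')), Finset.mul_sum]
  refine Finset.sum_le_sum fun y _ => ?_
  calc ∑ b' ∈ Finset.univ.filter (fun b' => blkOfBond F K k b' = y), f (blkOfBond F K k b')
      = ∑ b' ∈ Finset.univ.filter (fun b' => blkOfBond F K k b' = y), f y :=
        Finset.sum_congr rfl fun b' hb' => by rw [(Finset.mem_filter.1 hb').2]
    _ = ((Finset.univ.filter (fun b' => blkOfBond F K k b' = y)).card : ℝ) * f y := by rw [Finset.sum_const, nsmul_eq_mul]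
    _ ≤ (((F.P K).L ^ (F.P K).d) ^ k : ℕ) * f y :=
        mul_le_mul_of_nonneg_right (by exact_mod_cast card_fiber_blkOfBond_le F K k hk y) (hf y)

end Count

/-! ## §2  One member: (KL-H) from (3.133)-shaped bounds on the record's zeroth sup-entry -/

section Member

variable (F : T4Family) (N : ℕ) (K k : ℕ) (Ω : ℕ → Set (Site (F.P K) 0)) (U₀ : GaugeField (F.P K) 0 (SU N)) (levB : PBond (F.P K) k → ℕ)
variable [Fact (0 < (F.L : ℝ))] [Fact (0 < (F.P K).eta k)]

/-- **NODE-00: EVERY (115) FINE-BOND WEIGHT IS `1`** (all levels `= k`, `L^kη_k = 1`), at any exponent. [cite: Balaban1985Variational, (115) p.294; Balaban1987RG1, (1.1)–(1.2) p.260] -/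
theorem levWeight_bondLevLit_eq_one_pow (hΩ : ∀ x, x ∈ Ω k) (n : ℕ) (b : Bond (F.P K).d (fun _ => (F.P K).sitesPerDir 0)) :
    levWeight (F.L : ℝ) ((F.P K).eta k) (bondLevLit F Ω k) n b = 1 := by
  have h1 := levWeight_bondLevLit_eq_one F k Ω hΩ b
  rw [levWeight_apply, pow_one] at h1
  rw [levWeight_apply, h1, one_pow]

variable [Fact (0 < c0Rec F K k)] [Fact (∀ c, 0 < wBRec F K k c)] (a : ℝ)
  (hpos : ∀ x, x ≠ 0 → 0 < RCLike.re ⟪x, laplaceAOfRecord F N k U₀ (QOfRecord F N k U₀) (QflatOfRecord F N k) a x⟫_ℂ)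
  (hQ : Function.Surjective (QOfRecord F N k U₀))

/-- **THE (KL-H) READING IS n07-e's COLUMN**: the fine-bond value `flat115 (H₁(U₀)(δ_y Z)) b′` of PT-B's letter is `h1Col0 y b′ Z`. [cite: Balaban1985BackgroundPropagators, (3.129) p.421, (3.133) p.422 (bookkeeping)] -/
theorem flat115_H1_single (y : PBond (F.P K) k) (Z : Matrix (Fin N) (Fin N) ℂ) (b' : Bond (F.P K).d (fun _ => (F.P K).sitesPerDir 0)) :
    flat115 (H1OfRecordAtBgFlat F N K k Ω U₀ levB a hpos hQ
        ((NegSup.equiv (levWeight (F.L : ℝ) ((F.P K).eta k) levB 0) (Matrix (Fin N) (Fin N) ℂ)).symm (Pi.single y Z))) b' =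
      h1Col0 F N K k Ω U₀ levB a hpos hQ y b' Z := by
  rw [flat115_apply, h1Col0_apply]
  rfl

/-- **THE ONE-BLOCK BOUND** `‖flat115 (H₁(U₀)(δ_y Z)) b′‖ ≤ ‖h1Col0 y b′‖_op·‖Z‖` — PT-B's `hHk` with `hk := ‖h1Col0‖_op`. [cite: Balaban1985Variational, (45) p.285; Balaban1985BackgroundPropagators, (3.133) p.422] -/
theorem norm_flat115_H1_single_le (y : PBond (F.P K) k) (Z : Matrix (Fin N) (Fin N) ℂ) (b' : Bond (F.P K).d (fun _ => (F.P K).sitesPerDir 0)) :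
    ‖flat115 (H1OfRecordAtBgFlat F N K k Ω U₀ levB a hpos hQ
        ((NegSup.equiv (levWeight (F.L : ℝ) ((F.P K).eta k) levB 0) (Matrix (Fin N) (Fin N) ℂ)).symm (Pi.single y Z))) b'‖ ≤
      ‖h1Col0 F N K k Ω U₀ levB a hpos hQ y b'‖ * ‖Z‖ := by
  rw [flat115_H1_single]
  exact ContinuousLinearMap.le_opNorm _ _

/-- **THE FINE-COLUMN SUM THROUGH THE BLOCK ENTRIES**: `Σ_{b′} ‖h1Col0 y b′‖ ≤ (L^d)^k · Σ_{y″} h1Entry0 y″ y` (each column is dominated by the sup-entry of its observation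
block, n07-e's ✓`opNorm_col0_le_h1Entry0`; at most `(L^d)^k` fine bonds per block, §1). [cite: Balaban1985BackgroundPropagators, (3.133) p.422; Balaban1984PropagatorsII, (2.52) p.232] -/
theorem sum_opNorm_h1Col0_le (hk : k ≤ (F.P K).m + (F.P K).K) (y : PBond (F.P K) k) :
    ∑ b' : Bond (F.P K).d (fun _ => (F.P K).sitesPerDir 0), ‖h1Col0 F N K k Ω U₀ levB a hpos hQ y b'‖ ≤
      (((F.P K).L ^ (F.P K).d) ^ k : ℕ) * ∑ y'' : PBond (F.P K) k, h1Entry0 F N K k Ω U₀ levB a hpos hQ y'' y := by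
  refine le_trans (Finset.sum_le_sum fun b' _ => opNorm_col0_le_h1Entry0 F N K k Ω U₀ levB a hpos hQ y b') ?_
  exact sum_over_blocks_le F K k hk (fun y'' => h1Entry0 F N K k Ω U₀ levB a hpos hQ y'' y) (fun _ => fsup_nonneg _)

/-- ★★ **(KL-H) AT ONE MEMBER FROM (3.133)-SHAPED ENTRY BOUNDS, NODE-00 REGIME.**  If every site lies in `Ω_k`, `k ≤ m + K`, and the zeroth sup-entry of the record's `H₁(U₀)` obeys
`h1Entry0 y y′ ≤ B₀e^{−ρ·d(y,y′)}` ((3.133) for `H₁` at the top level, `d` = `tdist` of the sources), then PT-B G1's SIX (KL-H) binders hold with `hk(b′, y) := ‖h1Col0 y b′‖_op` and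
`Θ_H = Θ_H^w := (L^d)^k · (B₀ · d(2(1+1∕ρ))^d)`: non-negativity, the one-block bound, the plain fine-column sums ((2.61) row sum over the B-index × the block count) and the
(3)∕(3)-weighted fine-column sums (node-00: all weights `1`). [cite: Balaban1985BackgroundPropagators, (3.126) p.420, (3.129) p.421, (3.132)–(3.133) p.422; Balaban1985Variational, (88) p.291; Balaban1984PropagatorsII, Lemma 2.1 (2.61) p.234] -/
theorem klH_of_h1EntryBounds (hΩ : ∀ x, x ∈ Ω k) (hk : k ≤ (F.P K).m + (F.P K).K) {B₀ ρ : ℝ} (hB₀ : 0 ≤ B₀) (hρ : 0 < ρ)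
    (h0 : ∀ y y' : PBond (F.P K) k, h1Entry0 F N K k Ω U₀ levB a hpos hQ y y' ≤ B₀ * Real.exp (-(ρ * (Site.tdist y.src y'.src : ℝ)))) :
    (∀ (b' : Bond (F.P K).d (fun _ => (F.P K).sitesPerDir 0)) (y : PBond (F.P K) k), 0 ≤ ‖h1Col0 F N K k Ω U₀ levB a hpos hQ y b'‖) ∧
    (∀ (y : PBond (F.P K) k) (Z : Matrix (Fin N) (Fin N) ℂ) (b' : Bond (F.P K).d (fun _ => (F.P K).sitesPerDir 0)),
      ‖flat115 (H1OfRecordAtBgFlat F N K k Ω U₀ levB a hpos hQ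
          ((NegSup.equiv (levWeight (F.L : ℝ) ((F.P K).eta k) levB 0) (Matrix (Fin N) (Fin N) ℂ)).symm (Pi.single y Z))) b'‖ ≤
        ‖h1Col0 F N K k Ω U₀ levB a hpos hQ y b'‖ * ‖Z‖) ∧
    (0 ≤ ((((F.P K).L ^ (F.P K).d) ^ k : ℕ) : ℝ) * (B₀ * ((F.P K).d * (2 * (1 + 1 / ρ)) ^ (F.P K).d))) ∧
    (∀ y : PBond (F.P K) k, ∑ b' : Bond (F.P K).d (fun _ => (F.P K).sitesPerDir 0), ‖h1Col0 F N K k Ω U₀ levB a hpos hQ y b'‖ ≤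
      ((((F.P K).L ^ (F.P K).d) ^ k : ℕ) : ℝ) * (B₀ * ((F.P K).d * (2 * (1 + 1 / ρ)) ^ (F.P K).d))) ∧
    (∀ (bb : Bond (F.P K).d (fun _ => (F.P K).sitesPerDir 0)) (y : PBond (F.P K) k),
      ∑ b' : Bond (F.P K).d (fun _ => (F.P K).sitesPerDir 0),
        levWeight (F.L : ℝ) ((F.P K).eta k) (bondLevLit F Ω k) 3 bb / levWeight (F.L : ℝ) ((F.P K).eta k) (bondLevLit F Ω k) 3 b' *
          ‖h1Col0 F N K k Ω U₀ levB a hpos hQ y b'‖ ≤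
      ((((F.P K).L ^ (F.P K).d) ^ k : ℕ) : ℝ) * (B₀ * ((F.P K).d * (2 * (1 + 1 / ρ)) ^ (F.P K).d))) := by
  have hC0 : (0 : ℝ) ≤ (F.P K).d * (2 * (1 + 1 / ρ)) ^ (F.P K).d := by positivity
  -- the (2.61) row sum over the SOURCE index of the entry (`tdist` is symmetric)
  have hrow : ∀ y : PBond (F.P K) k,
      ∑ y'' : PBond (F.P K) k, h1Entry0 F N K k Ω U₀ levB a hpos hQ y'' y ≤ B₀ * ((F.P K).d * (2 * (1 + 1 / ρ)) ^ (F.P K).d) := by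
    intro y
    calc ∑ y'' : PBond (F.P K) k, h1Entry0 F N K k Ω U₀ levB a hpos hQ y'' y
        ≤ ∑ y'' : PBond (F.P K) k, B₀ * Real.exp (-(ρ * (Site.tdist y.src y''.src : ℝ))) :=
          Finset.sum_le_sum fun y'' _ => by rw [tdist_comm_rec F K]; exact h0 y'' y
      _ = B₀ * ∑ y'' : PBond (F.P K) k, Real.exp (-(ρ * (Site.tdist y.src y''.src : ℝ))) := by rw [Finset.mul_sum]
      _ ≤ B₀ * ((F.P K).d * (2 * (1 + 1 / ρ)) ^ (F.P K).d) := mul_le_mul_of_nonneg_left (rowSum_PBond_le F K k y hρ) hB₀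
  have hsum : ∀ y : PBond (F.P K) k, ∑ b' : Bond (F.P K).d (fun _ => (F.P K).sitesPerDir 0), ‖h1Col0 F N K k Ω U₀ levB a hpos hQ y b'‖ ≤
      ((((F.P K).L ^ (F.P K).d) ^ k : ℕ) : ℝ) * (B₀ * ((F.P K).d * (2 * (1 + 1 / ρ)) ^ (F.P K).d)) := fun y =>
    (sum_opNorm_h1Col0_le F N K k Ω U₀ levB a hpos hQ hk y).trans (mul_le_mul_of_nonneg_left (hrow y) (Nat.cast_nonneg _))
  refine ⟨fun b' y => ContinuousLinearMap.opNorm_nonneg (h1Col0 F N K k Ω U₀ levB a hpos hQ y b'), fun y Z b' => norm_flat115_H1_single_le F N K k Ω U₀ levB a hpos hQ y Z b',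
    mul_nonneg (Nat.cast_nonneg _) (mul_nonneg hB₀ hC0), hsum, fun bb y => ?_⟩
  calc ∑ b' : Bond (F.P K).d (fun _ => (F.P K).sitesPerDir 0),
        levWeight (F.L : ℝ) ((F.P K).eta k) (bondLevLit F Ω k) 3 bb / levWeight (F.L : ℝ) ((F.P K).eta k) (bondLevLit F Ω k) 3 b' *
          ‖h1Col0 F N K k Ω U₀ levB a hpos hQ y b'‖
      = ∑ b' : Bond (F.P K).d (fun _ => (F.P K).sitesPerDir 0), ‖h1Col0 F N K k Ω U₀ levB a hpos hQ y b'‖ :=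
        Finset.sum_congr rfl fun b' _ => by
          rw [levWeight_bondLevLit_eq_one_pow F K k Ω hΩ 3 bb, levWeight_bondLevLit_eq_one_pow F K k Ω hΩ 3 b', div_one, one_mul]
    _ ≤ _ := hsum y

end Member

/-! ## §3  The family: (KL-H) from `B9.Thm312Printed` at the record BY NAME — the same antecedent as (ℓa-H) -/

section Family

variable (F : T4Family) (N : ℕ) (a : ℝ)

/-- ★★★ **(KL-H) FROM [B9] THEOREM 3.12 AS PRINTED, BY NAME, AT THE RECORD (NODE-00 REGIME) — ONE DISPLAYED ROW FOR (ℓa-H) AND (KL-H).**  IF `B9.Thm312Printed 4 c35 (geoRecN00 F)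
(bgRecN00 F N R35 R36) GD G₁ H (h1KernelRecN00 F N a R35 R36) …` holds (dag-n07-e's displayed antecedent VERBATIM — any completion of the unread clauses; only the `H₁`-clause (3.133),
zeroth sup-entry, is used) THEN `∃ M₄ a₀ B₀ ρ > 0` with, for EVERY member `i` (`M₄ ≤ Mc_i`, standing range `k ≤ m + K`), every `0 < α₀` (`Mc_i·α₀ ≤ a₀`), every `U₀` in the displayed
classes `R35 ∕ R36 i c35 α₀` and every pair of def-Y's displayed proofs `hpos hQ`: PT-B G1's (KL-H) binders at `hk(b′, y) := ‖h1Col0 … y b′‖_op`, `Θ_H = Θ_H^w := (L^d)^k · B₀ ·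
d(2(1+1∕ρ))^d` (`B₀, ρ = δ₀∕2` bound BEFORE the member).  With n07-e's ✓`prop4LetterHAtRecord_of_thm312Printed` this makes (ℓa-H) AND (KL-H) consequences of ONE displayed row.
DISPLAYED, not proved: Theorem 3.12 at the record (XL; a second instance of N06's row 20), `R35 ∕ R36`, `hpos ∕ hQ`.
[cite: Balaban1985BackgroundPropagators, Thm 3.12 pp.421–424, (3.129) p.421, (3.132)–(3.133) p.422, (3.35)–(3.36) p.396; Balaban1985Variational, (45) p.285, (88) p.291; Balaban1984PropagatorsII, Lemma 2.1 (2.61) p.234] -/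
theorem klH_of_thm312Printed [Fact (0 < (F.L : ℝ))] {c35 : ℝ}
    {R35 R36 : ∀ i : MemberN00 F, ℝ → ℝ → GaugeField (F.P i.K) 0 (SU N) → Prop}
    {GD G₁ : ∀ i : MemberN00 F, B9.KernelFamily (geoRecN00 F i) (bgRecN00 F N R35 R36 i)}
    {H : ∀ i : MemberN00 F, B9.HKernel (geoRecN00 F i) (bgRecN00 F N R35 R36 i)}
    {HasRWExp : ∀ i : MemberN00 F, B9.KernelFamily (geoRecN00 F i) (bgRecN00 F N R35 R36 i) → (bgRecN00 F N R35 R36 i).Cfg → ℝ → Prop}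
    {HasRWExpH : ∀ i : MemberN00 F, B9.HKernel (geoRecN00 F i) (bgRecN00 F N R35 R36 i) → (bgRecN00 F N R35 R36 i).Cfg → ℝ → Prop}
    {PosDefK : ∀ i : MemberN00 F, B9.KernelFamily (geoRecN00 F i) (bgRecN00 F N R35 R36 i) → (bgRecN00 F N R35 R36 i).Cfg → Prop}
    (h312 : B9.Thm312Printed 4 c35 (geoRecN00 F) (bgRecN00 F N R35 R36) GD G₁ H (h1KernelRecN00 F N a R35 R36) HasRWExp HasRWExpH PosDefK) :
    ∃ M₄ a₀ B₀ ρ : ℝ, 0 < M₄ ∧ 0 < a₀ ∧ 0 < B₀ ∧ 0 < ρ ∧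
      ∀ i : MemberN00 F, M₄ ≤ (i.Mc : ℝ) → i.k ≤ (F.P i.K).m + (F.P i.K).K → ∀ α₀ : ℝ, 0 < α₀ → (i.Mc : ℝ) * α₀ ≤ a₀ →
        ∀ U₀ : GaugeField (F.P i.K) 0 (SU N), R35 i c35 α₀ U₀ → R36 i c35 α₀ U₀ →
          haveI := factEta F i.K i.k
          haveI := factC0 F i.K i.k
          haveI := wBRec_fact F i.K i.k
          ∀ (hpos : ∀ x, x ≠ 0 → 0 < RCLike.re ⟪x, laplaceAOfRecord F N i.k U₀ (QOfRecord F N i.k U₀) (QflatOfRecord F N i.k) a x⟫_ℂ)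
            (hQ : Function.Surjective (QOfRecord F N i.k U₀)),
            (∀ (b' : Bond (F.P i.K).d (fun _ => (F.P i.K).sitesPerDir 0)) (y : PBond (F.P i.K) i.k), 0 ≤ ‖h1Col0 F N i.K i.k i.Ω U₀ i.levB a hpos hQ y b'‖) ∧
            (∀ (y : PBond (F.P i.K) i.k) (Z : Matrix (Fin N) (Fin N) ℂ) (b' : Bond (F.P i.K).d (fun _ => (F.P i.K).sitesPerDir 0)),
              ‖flat115 (H1OfRecordAtBgFlat F N i.K i.k i.Ω U₀ i.levB a hpos hQ
                  ((NegSup.equiv (levWeight (F.L : ℝ) ((F.P i.K).eta i.k) i.levB 0) (Matrix (Fin N) (Fin N) ℂ)).symm (Pi.single y Z))) b'‖ ≤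
                ‖h1Col0 F N i.K i.k i.Ω U₀ i.levB a hpos hQ y b'‖ * ‖Z‖) ∧
            (0 ≤ ((((F.P i.K).L ^ (F.P i.K).d) ^ i.k : ℕ) : ℝ) * (B₀ * ((F.P i.K).d * (2 * (1 + 1 / ρ)) ^ (F.P i.K).d))) ∧
            (∀ y : PBond (F.P i.K) i.k, ∑ b' : Bond (F.P i.K).d (fun _ => (F.P i.K).sitesPerDir 0), ‖h1Col0 F N i.K i.k i.Ω U₀ i.levB a hpos hQ y b'‖ ≤
              ((((F.P i.K).L ^ (F.P i.K).d) ^ i.k : ℕ) : ℝ) * (B₀ * ((F.P i.K).d * (2 * (1 + 1 / ρ)) ^ (F.P i.K).d))) ∧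
            (∀ (bb : Bond (F.P i.K).d (fun _ => (F.P i.K).sitesPerDir 0)) (y : PBond (F.P i.K) i.k),
              ∑ b' : Bond (F.P i.K).d (fun _ => (F.P i.K).sitesPerDir 0),
                levWeight (F.L : ℝ) ((F.P i.K).eta i.k) (bondLevLit F i.Ω i.k) 3 bb / levWeight (F.L : ℝ) ((F.P i.K).eta i.k) (bondLevLit F i.Ω i.k) 3 b' *
                  ‖h1Col0 F N i.K i.k i.Ω U₀ i.levB a hpos hQ y b'‖ ≤
              ((((F.P i.K).L ^ (F.P i.K).d) ^ i.k : ℕ) : ℝ) * (B₀ * ((F.P i.K).d * (2 * (1 + 1 / ρ)) ^ (F.P i.K).d))) := by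
  obtain ⟨M₄, δ₀, a₀, B₀, Bβ, _Bε, _Bεβ, hM₄, hδ₀, ha₀, hB₀, h⟩ := h312
  refine ⟨M₄, a₀, B₀, δ₀ / 2, hM₄, ha₀, hB₀, half_pos hδ₀, fun i hM hk α₀ hα₀ hMa U₀ h35 h36 hpos hQ => ?_⟩
  haveI := factEta F i.K i.k
  haveI := factC0 F i.K i.k
  haveI := wBRec_fact F i.K i.k
  have hmem : h1KernelRecN00 F N a R35 R36 i ∈ [H i, h1KernelRecN00 F N a R35 R36 i] := by simp
  have h3133 := ((h i hM α₀ hα₀ hMa U₀ h35 h36).2 _ hmem).1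
  have hent : ∀ y y' : PBond (F.P i.K) i.k,
      h1Entry0 F N i.K i.k i.Ω U₀ i.levB a hpos hQ y y' ≤ B₀ * Real.exp (-(δ₀ / 2 * (Site.tdist y.src y'.src : ℝ))) := by
    intro y y'
    have h1 := h3133.1 0 y y'
    rw [geoRecN00_len, geoRecN00_len, Real.one_rpow, Real.one_rpow, mul_one, mul_one] at h1
    simpa only [h1KernelRecN00_e_eq F N a R35 R36 i U₀ hpos hQ, Fin.val_zero, if_true] using h1
  exact klH_of_h1EntryBounds F N i.K i.k i.Ω U₀ i.levB a hpos hQ i.hΩ hk hB₀.le (half_pos hδ₀) hent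

end Family

end Summit.QuantumFields.YangMills.BalabanUVNodes.N07KLHOfThm312

end
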